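import Literature.AlgebraicGeometry.CossartJannsenSaito2020.BlowupTowerLocalizeIso
import HarnessLib

/-!
# «`π` induces an isomorphism `C' ⥲ C`» composes, and holds for preimages under isomorphisms
# — bookkeeping for CJS LNM 2270, Def. 6.38 (iv) read on a COMPRESSED localised chain tower

Stub worker res-L1-w42-stub-1 (gen 3), crux chain w42 (`SigmaMaxModifications` stmt-ResolutionOfSingularities-18506 / conjunct
stmt-…-19249); helper `--supports stmt-ResolutionOfSingularities-19249 --as helper`; kernel only, no named fact, no new definition. For the
RECOGNITION clause `iso` of `Seg.UnitCentreDiscipline` (`…Corridor3WLadderSegmentsExtract`) on the compressed tower `Seg.unitTower`, whose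
projections are composites `hop ≫ π` of a blow-up with the (isomorphic) skipped blow-ups:

* `InducesIsoOn.comp` — `C'' ⥲ C'` over `g` and `C' ⥲ C` over `f` give `C'' ⥲ C` over `g ≫ f`;
* `inducesIsoOn_preimage_of_isIso` — an ISOMORPHISM `e : Y' ⟶ Y` induces `e⁻¹(C) ⥲ C` for every closed `C ⊆ Y` (reduced structures;
  res-type-053's `exists_subschemeIso_comap_of_isPullback` on the square `e ≫ 𝟙 = e ≫ 𝟙` and `comap_vanishingIdeal_eq_of_flat_of_isPreimmersion`).

OURS bookkeeping; NOT a statement of the manuscript [Hironaka2017] nor of [CossartJannsenSaito2020]. AI-written; AI review is weaker than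
expert review.

References: V. Cossart, U. Jannsen, S. Saito, LNM 2270 (2020), Def. 6.34 (iii), Def. 6.38 (iv) [CossartJannsenSaito2020];
U. Görtz, T. Wedhorn, *Algebraic Geometry I* (2nd ed.), Prop. 13.91 (2) [GortzWedhorn2020].
-/

noncomputable section

open CategoryTheory CategoryTheory.Limits AlgebraicGeometry TopologicalSpace
open Literature.AlgebraicGeometry.Resolution
open Scheme.IdealSheafData

namespace Literature.AlgebraicGeometry.CossartJannsenSaito2020

universe u

/-- **`InducesIsoOn` composes**: `C'' ⥲ C'` over `g` and `C' ⥲ C` over `f` give `C'' ⥲ C` over `g ≫ f`.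
[cite: CossartJannsenSaito2020, Def. 6.34 (iii)] -/
theorem InducesIsoOn.comp {Y'' Y' Y : Scheme.{u}} {g : Y'' ⟶ Y'} {f : Y' ⟶ Y} {C'' : Set Y''} {h'' : IsClosed C''} {C' : Set Y'}
    {h' : IsClosed C'} {C : Set Y} {h : IsClosed C} (hg : InducesIsoOn g C'' h'' C' h') (hf : InducesIsoOn f C' h' C h) :
    InducesIsoOn (g ≫ f) C'' h'' C h := by
  obtain ⟨e'', he''⟩ := hg
  obtain ⟨e', he'⟩ := hf
  refine ⟨e'' ≪≫ e', ?_⟩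
  rw [Iso.trans_hom, Category.assoc, he', ← Category.assoc, he'', Category.assoc]

/-- **An isomorphism induces `e⁻¹(C) ⥲ C`** on every closed subset with its reduced structure. [cite: GortzWedhorn2020, Prop. 13.91 (2)] -/
theorem inducesIsoOn_preimage_of_isIso {Y' Y : Scheme.{u}} (e : Y' ⟶ Y) [IsIso e] (C : Set Y) (hC : IsClosed C) :
    InducesIsoOn e (e.base ⁻¹' C) (hC.preimage e.continuous) C hC := by
  -- the square `e ≫ 𝟙 = e ≫ 𝟙` is cartesian
  have H : IsPullback e e (𝟙 Y) (𝟙 Y) := IsPullback.of_horiz_isIso ⟨by simp⟩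
  have hJ' : vanishingIdeal ⟨e.base ⁻¹' C, hC.preimage e.continuous⟩ = (vanishingIdeal ⟨C, hC⟩).comap e :=
    (comap_vanishingIdeal_eq_of_flat_of_isPreimmersion e ⟨C, hC⟩).symm
  have hJ : vanishingIdeal ⟨C, hC⟩ = (vanishingIdeal ⟨C, hC⟩).comap (𝟙 Y) :=
    (comap_vanishingIdeal_eq_of_flat_of_isPreimmersion (𝟙 Y) ⟨C, hC⟩).symm
  have key := exists_subschemeIso_comap_of_isPullback H (vanishingIdeal ⟨C, hC⟩) (vanishingIdeal ⟨C, hC⟩) (Iso.refl _) (by simp)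
  rw [← hJ] at key
  unfold InducesIsoOn
  rw [hJ']
  exact key

end Literature.AlgebraicGeometry.CossartJannsenSaito2020

end
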